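import Mathlib.LinearAlgebra.Matrix.ToLin
import Mathlib.LinearAlgebra.Matrix.Rank
import Mathlib.LinearAlgebra.FiniteDimensional.Basic
import Literature.Computability.AlgebraicComplexity.FlatteningBound
import Literature.Computability.AlgebraicComplexity.SmallFormatRankFlag
import HarnessLib

/-!
# Computations of `⟨c,m,n⟩`: transport, padding, conciseness, adapted coordinates (Bläser 2003, §3)

Topic `Literature/Computability/AlgebraicComplexity`. Fourth proof file behind
`SmallFormatRank.lean` (target `blaser2003_thm14`, Bläser 2003, Thm. 14), on top of
`SmallFormatRankSubstitution.lean` (computations, separation) and `SmallFormatRankFlag.lean`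
(`mulBilin`, the flag subspaces, Lemma 5).

## Content

* `BilinComp.comap` — transport of a computation along linear maps `A, B, C` with
  `ψ(x,y) = C φ(Ax, By)`; `BilinComp.extend` — padding by zero triples;
  `BilinComp.sandwich` (`w ↦ u w v`) and `BilinComp.transposed` (`w ↦ wᵀ`, `f ↔ g`) — the
  equivalence transformations of Bläser 2003, §3.
* `bilinCompOfTriads`, `exists_bilinComp_of_tensorRank_le` — the bridge from
  `tensorRank (matMulTensor k c m n) ≤ r` (triad decompositions, `MatrixMultiplicationExponent`)
  to bilinear computations of `⟨c,m,n⟩` of length exactly `r`.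
* `BilinComp.eq_zero_of_forall_f`, `eq_zero_of_forall_g`, `span_w_eq_top` — conciseness of
  `⟨c,m,n⟩`: the `f_i`, `g_i` have no common zero and the `w_i` span.
* `exists_linearEquiv_adapted`, `exists_rows_adapted`, `topZero` — coordinates adapted to a
  subspace / to the column space of a matrix `a`: invertible `u` with
  `u a k^{m×n} = {z | first n − rk a rows of z vanish}` (what "by sandwiching we may assume that
  `a` has the form `[0 0; 0 I]`", Bläser 2003 p. 51, is used for).

## References

* M. Bläser, *On the complexity of the multiplication of matrices of small formats*,
  J. Complexity 19 (2003) 43–60, §3 (equivalence of computations), §4 pp. 50–52. [Blaser2003]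
-/

namespace Literature.Computability.AlgebraicComplexity

open Module Matrix

variable {k : Type*} [Field k]

/-! ## Transport and padding of computations (Bläser 2003, §3) -/

namespace BilinComp

variable {U V W : Type*} [AddCommGroup U] [Module k U] [AddCommGroup V] [Module k V]
  [AddCommGroup W] [Module k W]
variable {U' V' W' : Type*} [AddCommGroup U'] [Module k U'] [AddCommGroup V'] [Module k V']
  [AddCommGroup W'] [Module k W']
variable {φ : U →ₗ[k] V →ₗ[k] W} {ψ : U' →ₗ[k] V' →ₗ[k] W'} {ι : Type*} [Fintype ι]

/-- Transport of a computation along linear maps `A, B, C` with `ψ(x, y) = C(φ(Ax, By))`: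
`(f_i ∘ A, g_i ∘ B, C w_i)` computes `ψ`. Sandwiching and transposition (Bläser 2003, §3) are
the instances below. [cite: Blaser2003, §3] -/
def comap (β : BilinComp φ ι) (A : U' →ₗ[k] U) (B : V' →ₗ[k] V) (C : W →ₗ[k] W')
    (h : ∀ x y, ψ x y = C (φ (A x) (B y))) : BilinComp ψ ι where
  f i := (β.f i).comp A
  g i := (β.g i).comp B
  w i := C (β.w i)
  map_eq_sum x y := by
    rw [h, β.map_eq_sum, map_sum]
    refine Finset.sum_congr rfl fun i _ => ?_
    rw [map_smul]
    rfl

/-- The forms of a transported computation. [cite: Blaser2003, §3] -/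
@[simp] theorem comap_f (β : BilinComp φ ι) (A : U' →ₗ[k] U) (B : V' →ₗ[k] V) (C : W →ₗ[k] W')
    (h : ∀ x y, ψ x y = C (φ (A x) (B y))) (i : ι) (x : U') :
    (β.comap A B C h).f i x = β.f i (A x) := rfl

/-- The forms of a transported computation. [cite: Blaser2003, §3] -/
@[simp] theorem comap_g (β : BilinComp φ ι) (A : U' →ₗ[k] U) (B : V' →ₗ[k] V) (C : W →ₗ[k] W')
    (h : ∀ x y, ψ x y = C (φ (A x) (B y))) (i : ι) (y : V') :
    (β.comap A B C h).g i y = β.g i (B y) := rfl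

/-- The vectors of a transported computation. [cite: Blaser2003, §3] -/
@[simp] theorem comap_w (β : BilinComp φ ι) (A : U' →ₗ[k] U) (B : V' →ₗ[k] V) (C : W →ₗ[k] W')
    (h : ∀ x y, ψ x y = C (φ (A x) (B y))) (i : ι) :
    (β.comap A B C h).w i = C (β.w i) := rfl

/-- Padding a computation by zero triples along an injection of index types (a computation of
length `r` gives one of every length `≥ r`). [folklore] -/
noncomputable def extend {κ : Type*} [Fintype κ] (β : BilinComp φ ι) (e : ι ↪ κ) :
    BilinComp φ κ where
  f := Function.extend e β.f 0
  g := Function.extend e β.g 0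
  w := Function.extend e β.w 0
  map_eq_sum u v := by
    classical
    rw [β.map_eq_sum]
    have hvan : ∀ j ∈ (Finset.univ : Finset κ), j ∉ Finset.univ.map e →
        (Function.extend e β.f 0 j u * Function.extend e β.g 0 j v) •
          Function.extend e β.w (0 : κ → W) j = 0 := by
      intro j _ hj
      have hj' : ¬ ∃ i, e i = j := fun ⟨i, hi⟩ => hj (Finset.mem_map.2 ⟨i, Finset.mem_univ _, hi⟩)
      rw [Function.extend_apply' _ _ _ hj']
      simp
    rw [← Finset.sum_subset (Finset.subset_univ _) hvan, Finset.sum_map]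
    refine Finset.sum_congr rfl fun i _ => ?_
    rw [e.injective.extend_apply, e.injective.extend_apply, e.injective.extend_apply]

/-- The vectors of a padded computation on the old indices. [folklore] -/
theorem extend_w_apply {κ : Type*} [Fintype κ] (β : BilinComp φ ι) (e : ι ↪ κ) (i : ι) :
    (β.extend e).w (e i) = β.w i :=
  e.injective.extend_apply _ _ _

end BilinComp

/-! ## From triad decompositions of `⟨c,m,n⟩` to bilinear computations -/

section Bridge

variable (k)

/-- A decomposition `⟨c,m,n⟩ = ∑_i w_i ⊗ u_i ⊗ v_i` of the matrix multiplication tensor into `r`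
triads is a bilinear computation of length `r` for `(x, y) ↦ xy`: `f_i(x) = ∑_b (u_i)_b x_b`,
`g_i(y) = ∑_c (v_i)_c y_c`, `w_i` read as a `c × n` matrix (Bläser 2013, Def. 4.4/4.5: rank =
bilinear complexity). [cite: Blaser2003, Def. 1] -/
noncomputable def bilinCompOfTriads {c m n : ℕ} {ι : Type*} [Fintype ι]
    (w : ι → (Fin c × Fin n → k)) (u : ι → (Fin c × Fin m → k)) (v : ι → (Fin m × Fin n → k))
    (ht : matMulTensor k c m n = ∑ i, triad (w i) (u i) (v i)) :
    BilinComp (mulBilin k c m n) ι where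
  f i :=
    { toFun := fun x => ∑ b : Fin c × Fin m, u i b * x b.1 b.2
      map_add' := fun x y => by simp [Finset.sum_add_distrib, mul_add]
      map_smul' := fun a x => by simp [Finset.mul_sum, mul_left_comm] }
  g i :=
    { toFun := fun y => ∑ c' : Fin m × Fin n, v i c' * y c'.1 c'.2
      map_add' := fun x y => by simp [Finset.sum_add_distrib, mul_add]
      map_smul' := fun a x => by simp [Finset.mul_sum, mul_left_comm] }
  w i := Matrix.of fun p q => w i (p, q)
  map_eq_sum x y := by
    rw [mulBilin_apply]
    ext p q
    -- both sides equal `∑_{b,c} T_{(p,q) b c} x_b y_c`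
    have key : ∀ (b : Fin c × Fin m) (c' : Fin m × Fin n),
        matMulTensor k c m n (p, q) b c' = ∑ i, w i (p, q) * u i b * v i c' := by
      intro b c'
      rw [ht]
      simp [Finset.sum_apply, triad_apply]
    have lhs : (x * y) p q = ∑ b : Fin c × Fin m, ∑ c' : Fin m × Fin n,
        matMulTensor k c m n (p, q) b c' * x b.1 b.2 * y c'.1 c'.2 := by
      rw [Matrix.mul_apply, Fintype.sum_prod_type]
      simp only [matMulTensor]
      rw [Finset.sum_eq_single p (fun b _ hb => by simp [Ne.symm hb]) (by simp)]
      refine Finset.sum_congr rfl fun μ _ => ?_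
      rw [Fintype.sum_prod_type]
      rw [Finset.sum_eq_single μ (fun b _ hb => by simp [Ne.symm hb]) (by simp)]
      rw [Finset.sum_eq_single q (fun b _ hb => by simp [Ne.symm hb]) (by simp)]
      simp
    rw [lhs, Matrix.sum_apply]
    simp only [Matrix.smul_apply, Matrix.of_apply, LinearMap.coe_mk, AddHom.coe_mk, smul_eq_mul]
    calc ∑ b : Fin c × Fin m, ∑ c' : Fin m × Fin n,
          matMulTensor k c m n (p, q) b c' * x b.1 b.2 * y c'.1 c'.2
        = ∑ b : Fin c × Fin m, ∑ c' : Fin m × Fin n, ∑ i,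
            w i (p, q) * u i b * v i c' * x b.1 b.2 * y c'.1 c'.2 := by
          simp_rw [key, Finset.sum_mul]
      _ = ∑ i, ∑ b : Fin c × Fin m, ∑ c' : Fin m × Fin n,
            w i (p, q) * u i b * v i c' * x b.1 b.2 * y c'.1 c'.2 := by
          trans ∑ b : Fin c × Fin m, ∑ i, ∑ c' : Fin m × Fin n,
            w i (p, q) * u i b * v i c' * x b.1 b.2 * y c'.1 c'.2
          · exact Finset.sum_congr rfl fun b _ => Finset.sum_comm
          · exact Finset.sum_comm
      _ = ∑ i, (∑ b : Fin c × Fin m, u i b * x b.1 b.2) *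
            (∑ c' : Fin m × Fin n, v i c' * y c'.1 c'.2) * w i (p, q) := by
          refine Finset.sum_congr rfl fun i _ => ?_
          rw [Finset.sum_mul_sum, Finset.sum_mul]
          refine Finset.sum_congr rfl fun b _ => ?_
          rw [Finset.sum_mul]
          refine Finset.sum_congr rfl fun c' _ => ?_
          ring

variable {k}

/-- If `R(⟨c,m,n⟩) ≤ r` then there is a bilinear computation of `⟨c,m,n⟩` of length exactly `r`
(the infimum defining the rank is attained, then pad with zero triples).
[cite: Blaser2003, Def. 1] -/
theorem exists_bilinComp_of_tensorRank_le {c m n r : ℕ}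
    (h : tensorRank (matMulTensor k c m n) ≤ r) :
    Nonempty (BilinComp (mulBilin k c m n) (Fin r)) := by
  obtain ⟨w, u, v, ht⟩ := exists_triad_decomposition_tensorRank (matMulTensor k c m n)
  exact ⟨(bilinCompOfTriads k w u v ht).extend (Fin.castLEEmb h)⟩

end Bridge

/-! ## Sandwiching and transposition (Bläser 2003, §3) -/

section Sandwich

variable {c m n : ℕ} {ι : Type*} [Fintype ι]

variable (k) in
/-- Left multiplication `x ↦ u x` on `k^{e×h}` by `u ∈ k^{e×e}`. [folklore] -/
def mulLeftLin {e h : ℕ} (u : Matrix (Fin e) (Fin e) k) :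
    Matrix (Fin e) (Fin h) k →ₗ[k] Matrix (Fin e) (Fin h) k where
  toFun x := u * x
  map_add' := Matrix.mul_add u
  map_smul' a x := Matrix.mul_smul u a x

variable (k) in
/-- Right multiplication `y ↦ y v` on `k^{e×h}` by `v ∈ k^{h×h}`. [folklore] -/
def mulRightLin {e h : ℕ} (v : Matrix (Fin h) (Fin h) k) :
    Matrix (Fin e) (Fin h) k →ₗ[k] Matrix (Fin e) (Fin h) k where
  toFun y := y * v
  map_add' x y := Matrix.add_mul x y v
  map_smul' a y := Matrix.smul_mul a y v

/-- `mulLeftLin u x = u x`. [folklore] -/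
@[simp] theorem mulLeftLin_apply {e h : ℕ} (u : Matrix (Fin e) (Fin e) k) (x : Matrix (Fin e) (Fin h) k) :
    mulLeftLin k u x = u * x := rfl

/-- `mulRightLin v y = y v`. [folklore] -/
@[simp] theorem mulRightLin_apply {e h : ℕ} (v : Matrix (Fin h) (Fin h) k) (y : Matrix (Fin e) (Fin h) k) :
    mulRightLin k v y = y * v := rfl

/-- **Sandwiching** (Bläser 2003, §3) by invertible `u ∈ k^{c×c}` (rows) and `v ∈ k^{n×n}`
(columns): from a computation of `⟨c,m,n⟩` the computation with `w̃_i = u w_i v`,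
`f̃_i(x) = f_i(u' x)`, `g̃_i(y) = g_i(y v')`, where `u u' = 1`, `v' v = 1`
(`xy = u (u'x)(yv') v`). (The middle factor `b ∈ k^{m×m}` of the printed transformation is not
needed here.) [cite: Blaser2003, §3] -/
noncomputable def BilinComp.sandwich (β : BilinComp (mulBilin k c m n) ι)
    (u u' : Matrix (Fin c) (Fin c) k) (v v' : Matrix (Fin n) (Fin n) k) (hu : u * u' = 1)
    (hv : v' * v = 1) : BilinComp (mulBilin k c m n) ι :=
  β.comap (mulLeftLin k u') (mulRightLin k v') ((mulLeftLin k u).comp (mulRightLin k v))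
    (fun x y => by
      simp only [mulBilin_apply, mulLeftLin_apply, mulRightLin_apply, LinearMap.comp_apply]
      rw [Matrix.mul_assoc (u' * x) (y * v') v, Matrix.mul_assoc y v' v, hv, Matrix.mul_one,
        ← Matrix.mul_assoc u (u' * x) y, ← Matrix.mul_assoc u u' x, hu, Matrix.one_mul])

/-- The vectors of the sandwiched computation are `u w_i v`. [cite: Blaser2003, §3] -/
@[simp] theorem BilinComp.sandwich_w (β : BilinComp (mulBilin k c m n) ι)
    (u u' : Matrix (Fin c) (Fin c) k) (v v' : Matrix (Fin n) (Fin n) k) (hu : u * u' = 1)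
    (hv : v' * v = 1) (i : ι) : (β.sandwich u u' v v' hu hv).w i = u * β.w i * v := by
  simp [BilinComp.sandwich, Matrix.mul_assoc]

/-- The first forms of the sandwiched computation. [cite: Blaser2003, §3] -/
@[simp] theorem BilinComp.sandwich_f (β : BilinComp (mulBilin k c m n) ι)
    (u u' : Matrix (Fin c) (Fin c) k) (v v' : Matrix (Fin n) (Fin n) k) (hu : u * u' = 1)
    (hv : v' * v = 1) (i : ι) (x : Matrix (Fin c) (Fin m) k) :
    (β.sandwich u u' v v' hu hv).f i x = β.f i (u' * x) := by
  simp [BilinComp.sandwich]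

/-- The second forms of the sandwiched computation. [cite: Blaser2003, §3] -/
@[simp] theorem BilinComp.sandwich_g (β : BilinComp (mulBilin k c m n) ι)
    (u u' : Matrix (Fin c) (Fin c) k) (v v' : Matrix (Fin n) (Fin n) k) (hu : u * u' = 1)
    (hv : v' * v = 1) (i : ι) (y : Matrix (Fin m) (Fin n) k) :
    (β.sandwich u u' v v' hu hv).g i y = β.g i (y * v') := by
  simp [BilinComp.sandwich]

/-- **Transposition** (Bläser 2003, §3, `β^⊤`): for the format `⟨n,m,n⟩`, exchanging the `f`'s
with the `g`'s and transposing gives again a computation of `⟨n,m,n⟩`: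
`f̄_i(x) = g_i(xᵀ)`, `ḡ_i(y) = f_i(yᵀ)`, `w̄_i = w_iᵀ` (`xy = (yᵀ xᵀ)ᵀ`). [cite: Blaser2003, §3] -/
noncomputable def BilinComp.transposed {n m : ℕ} (β : BilinComp (mulBilin k n m n) ι) :
    BilinComp (mulBilin k n m n) ι :=
  β.flip.comap
    (Matrix.transposeLinearEquiv (Fin n) (Fin m) k k :
      Matrix (Fin n) (Fin m) k →ₗ[k] Matrix (Fin m) (Fin n) k)
    (Matrix.transposeLinearEquiv (Fin m) (Fin n) k k :
      Matrix (Fin m) (Fin n) k →ₗ[k] Matrix (Fin n) (Fin m) k)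
    (Matrix.transposeLinearEquiv (Fin n) (Fin n) k k :
      Matrix (Fin n) (Fin n) k →ₗ[k] Matrix (Fin n) (Fin n) k)
    (fun x y => by simp [Matrix.transpose_mul])

/-- The vectors of the transposed computation. [cite: Blaser2003, §3] -/
@[simp] theorem BilinComp.transposed_w {n m : ℕ} (β : BilinComp (mulBilin k n m n) ι) (i : ι) :
    β.transposed.w i = (β.w i)ᵀ := rfl

/-- The first forms of the transposed computation. [cite: Blaser2003, §3] -/
@[simp] theorem BilinComp.transposed_f {n m : ℕ} (β : BilinComp (mulBilin k n m n) ι) (i : ι)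
    (x : Matrix (Fin n) (Fin m) k) : β.transposed.f i x = β.g i xᵀ := rfl

/-- The second forms of the transposed computation. [cite: Blaser2003, §3] -/
@[simp] theorem BilinComp.transposed_g {n m : ℕ} (β : BilinComp (mulBilin k n m n) ι) (i : ι)
    (y : Matrix (Fin m) (Fin n) k) : β.transposed.g i y = β.f i yᵀ := rfl

end Sandwich

/-! ## Conciseness of `⟨c,m,n⟩`: the `f_i`, `g_i`, `w_i` of any computation span -/

section Concise

variable {c m n : ℕ} {ι : Type*} [Fintype ι]

/-- The forms `f_i` of a computation of `⟨c,m,n⟩` (`n ≥ 1`) have no common zero `x ≠ 0`: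
`x E_{μ1} = ∑ f_i(x) g_i(E_{μ1}) w_i`. [cite: Blaser2003, §4 p. 50] -/
theorem BilinComp.eq_zero_of_forall_f (β : BilinComp (mulBilin k c m n) ι) (hn : 0 < n)
    (x : Matrix (Fin c) (Fin m) k) (hx : ∀ i, β.f i x = 0) : x = 0 := by
  ext l μ
  have h := β.map_eq_sum x (Matrix.single μ (⟨0, hn⟩ : Fin n) 1)
  simp only [hx, zero_mul, zero_smul, Finset.sum_const_zero, mulBilin_apply] at h
  have := congrFun (congrFun h l) ⟨0, hn⟩
  simpa [mul_single_apply'] using this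

/-- The forms `g_i` of a computation of `⟨c,m,n⟩` (`c ≥ 1`) have no common zero `y ≠ 0`.
[cite: Blaser2003, §4 p. 50] -/
theorem BilinComp.eq_zero_of_forall_g (β : BilinComp (mulBilin k c m n) ι) (hc : 0 < c)
    (y : Matrix (Fin m) (Fin n) k) (hy : ∀ i, β.g i y = 0) : y = 0 := by
  ext μ j
  have h := β.map_eq_sum (Matrix.single (⟨0, hc⟩ : Fin c) μ 1) y
  simp only [hy, mul_zero, zero_smul, Finset.sum_const_zero, mulBilin_apply] at h
  have := congrFun (congrFun h ⟨0, hc⟩) j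
  simpa [single_mul_apply'] using this

/-- The vectors `w_i` of a computation of `⟨c,m,n⟩` (`m ≥ 1`) span `k^{c×n}`
("`w_1, …, w_r` generate `k^{n×n}`", Bläser 2003, p. 52). [cite: Blaser2003, §4 p. 52] -/
theorem BilinComp.span_w_eq_top (β : BilinComp (mulBilin k c m n) ι) (hm : 0 < m) :
    Submodule.span k (Set.range β.w) = ⊤ := by
  classical
  rw [eq_top_iff]
  intro z _
  rw [Matrix.matrix_eq_sum_single z]
  refine Submodule.sum_mem _ fun i _ => Submodule.sum_mem _ fun j _ => ?_
  have hsingle : Matrix.single i j (z i j) =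
      z i j • (Matrix.single i (⟨0, hm⟩ : Fin m) (1 : k) * Matrix.single (⟨0, hm⟩ : Fin m) j (1 : k)) := by
    rw [Matrix.single_mul_single_same, mul_one, Matrix.smul_single, smul_eq_mul, mul_one]
  rw [hsingle]
  refine Submodule.smul_mem _ _ ?_
  have h := β.map_eq_sum (Matrix.single i (⟨0, hm⟩ : Fin m) (1 : k))
    (Matrix.single (⟨0, hm⟩ : Fin m) j (1 : k))
  rw [mulBilin_apply] at h
  rw [h]
  exact Submodule.sum_mem _ fun l _ => Submodule.smul_mem _ _ (Submodule.subset_span ⟨l, rfl⟩)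

end Concise

/-! ## Coordinates adapted to a subspace of `k^n` -/

section Adapted

/-- For a subspace `P ⊆ k^n` of dimension `α` there is a linear automorphism `L` of `k^n` in whose
coordinates `P` is `{x | x_i = 0 for i < n − α}` ("by sandwiching we may assume that `a` has the
form …", Bläser 2003, p. 51). [cite: Blaser2003, §4 p. 51] -/
theorem exists_linearEquiv_adapted {n : ℕ} (P : Submodule k (Fin n → k)) {α : ℕ}
    (hP : finrank k P = α) :
    ∃ L : (Fin n → k) ≃ₗ[k] (Fin n → k), ∀ x, x ∈ P ↔ ∀ i : Fin n, (i : ℕ) < n - α → L x i = 0 := by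
  classical
  obtain ⟨Q, hPQ⟩ := P.exists_isCompl
  have hαn : α ≤ n := by
    rw [← hP]; simpa using Submodule.finrank_le P
  have hQ : finrank k Q = n - α := by
    have h := Submodule.finrank_add_eq_of_isCompl hPQ
    simp only [finrank_fintype_fun_eq_card, Fintype.card_fin] at h
    omega
  let eP : P ≃ₗ[k] (Fin α → k) := (Module.finBasisOfFinrankEq k P hP).equivFun
  let eQ : Q ≃ₗ[k] (Fin (n - α) → k) := (Module.finBasisOfFinrankEq k Q hQ).equivFun
  let πP : (Fin n → k) →ₗ[k] P := P.projectionOnto Q hPQ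
  let πQ : (Fin n → k) →ₗ[k] Q := Q.projectionOnto P hPQ.symm
  -- coordinate `i`: a `Q`-coordinate for `i < n - α`, a `P`-coordinate otherwise
  let Lc : Fin n → ((Fin n → k) →ₗ[k] k) := fun i =>
    if h : (i : ℕ) < n - α then (LinearMap.proj (⟨i, h⟩ : Fin (n - α))).comp (eQ.toLinearMap.comp πQ)
    else (LinearMap.proj (⟨i - (n - α), by omega⟩ : Fin α)).comp (eP.toLinearMap.comp πP)
  let L₀ : (Fin n → k) →ₗ[k] (Fin n → k) := LinearMap.pi Lc
  have hL₀ : ∀ x i, L₀ x i = if h : (i : ℕ) < n - α then eQ (πQ x) ⟨i, h⟩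
      else eP (πP x) ⟨i - (n - α), by omega⟩ := by
    intro x i
    simp only [L₀, Lc, LinearMap.pi_apply]
    split_ifs <;> rfl
  have hinj : Function.Injective L₀ := by
    rw [← LinearMap.ker_eq_bot, LinearMap.ker_eq_bot']
    intro x hx
    have hQ0 : eQ (πQ x) = 0 := by
      funext j
      have := congrFun hx ⟨j, by omega⟩
      rw [hL₀, dif_pos (by simp)] at this
      simpa using this
    have hP0 : eP (πP x) = 0 := by
      funext j
      have := congrFun hx ⟨j + (n - α), by omega⟩
      rw [hL₀, dif_neg (by simp)] at this
      simpa using this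
    have hQ0' : πQ x = 0 := eQ.injective (by rw [hQ0, map_zero])
    have hP0' : πP x = 0 := eP.injective (by rw [hP0, map_zero])
    have := Submodule.projection_add_projection_eq_self hPQ x
    rw [Submodule.projection_apply, Submodule.projection_apply] at this
    rw [← this]
    change ((πP x : (Fin n → k)) + (πQ x : (Fin n → k))) = 0
    rw [hP0', hQ0']; simp
  refine ⟨LinearEquiv.ofInjectiveEndo L₀ hinj, fun x => ?_⟩
  simp only [LinearEquiv.coe_ofInjectiveEndo]
  constructor
  · intro hx i hi
    rw [hL₀, dif_pos hi]
    have : πQ x = 0 := (Submodule.projectionOnto_apply_eq_zero_iff hPQ.symm).2 hx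
    rw [this, map_zero]; rfl
  · intro h
    have hQ0 : eQ (πQ x) = 0 := by
      funext j
      have := h ⟨j, by omega⟩ (by simp)
      rw [hL₀, dif_pos (by simp)] at this
      simpa using this
    have : πQ x = 0 := eQ.injective (by rw [hQ0, map_zero])
    exact (Submodule.projectionOnto_apply_eq_zero_iff hPQ.symm).1 this

/-- The matrices of `k^{e×h}` whose first `q` rows vanish (the shape of `S = a k^{m×n}` after
the rows have been adapted to `a`, Bläser 2003, p. 51–52). [cite: Blaser2003, §4 p. 52] -/
def topZero (k : Type*) [Field k] (e h q : ℕ) : Submodule k (Matrix (Fin e) (Fin h) k) where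
  carrier := {x | ∀ (i : Fin e) (j : Fin h), (i : ℕ) < q → x i j = 0}
  add_mem' ha hb i j hi := by simp [ha i j hi, hb i j hi]
  zero_mem' _ _ _ := rfl
  smul_mem' c x hx i j hi := by simp [hx i j hi]

/-- Membership in `topZero`. [cite: Blaser2003, §4 p. 52] -/
@[simp] theorem mem_topZero {e h q : ℕ} {x : Matrix (Fin e) (Fin h) k} :
    x ∈ topZero k e h q ↔ ∀ (i : Fin e) (j : Fin h), (i : ℕ) < q → x i j = 0 := Iff.rfl

/-- Entries of `u (a y)`: column `j` is `u` applied to `a` applied to column `j` of `y`. [folklore] -/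
theorem mul_mul_apply_eq_mulVec {n m : ℕ} (u : Matrix (Fin n) (Fin n) k) (a : Matrix (Fin n) (Fin m) k)
    (y : Matrix (Fin m) (Fin n) k) (i j : Fin n) :
    (u * (a * y)) i j = (u *ᵥ (a *ᵥ fun μ => y μ j)) i := by
  simp only [Matrix.mul_apply, Matrix.mulVec, dotProduct]

/-- **Rows adapted to `a`.** For `a ∈ k^{n×m}` of rank `α` there are mutually inverse
`u, u' ∈ k^{n×n}` such that `u a k^{m×n}` is exactly the space of matrices whose first `n − α`
rows vanish (Bläser 2003, p. 51: "by sandwiching, we may assume that `a` has the form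
`[0 0; 0 I_{rk a}]`", of which only this consequence is used). [cite: Blaser2003, §4 p. 51] -/
theorem exists_rows_adapted {n m : ℕ} (a : Matrix (Fin n) (Fin m) k) :
    ∃ u u' : Matrix (Fin n) (Fin n) k, u * u' = 1 ∧ u' * u = 1 ∧
      ∀ z : Matrix (Fin n) (Fin n) k,
        (∃ y : Matrix (Fin m) (Fin n) k, u * (a * y) = z) ↔ z ∈ topZero k n n (n - a.rank) := by
  classical
  obtain ⟨L, hL⟩ := exists_linearEquiv_adapted (LinearMap.range a.mulVecLin) (α := a.rank) rfl
  refine ⟨LinearMap.toMatrix' L.toLinearMap, LinearMap.toMatrix' L.symm.toLinearMap, ?_, ?_, ?_⟩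
  · rw [← LinearMap.toMatrix'_comp]; simp
  · rw [← LinearMap.toMatrix'_comp]; simp
  · intro z
    constructor
    · rintro ⟨y, rfl⟩ i j hi
      rw [mul_mul_apply_eq_mulVec, LinearMap.toMatrix'_mulVec]
      exact (hL _).1 ⟨_, rfl⟩ i hi
    · intro hz
      -- each column of `z` lies in `L(range a)`
      have hcol : ∀ j, ∃ cj : Fin m → k, a *ᵥ cj = L.symm (fun i => z i j) := by
        intro j
        have : L.symm (fun i => z i j) ∈ LinearMap.range a.mulVecLin := by
          rw [hL]
          intro i hi
          simpa using hz i j hi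
        obtain ⟨cj, hcj⟩ := this
        exact ⟨cj, hcj⟩
      choose cvec hcvec using hcol
      refine ⟨Matrix.of fun μ j => cvec j μ, ?_⟩
      ext i j
      rw [mul_mul_apply_eq_mulVec, LinearMap.toMatrix'_mulVec]
      have : (a *ᵥ fun μ => Matrix.of (fun μ j => cvec j μ) μ j) = a *ᵥ cvec j := rfl
      rw [this, hcvec]
      simp

end Adapted

end Literature.Computability.AlgebraicComplexity
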